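import Summits.AtomisticToContinuum.FouriersLaw.Theorems.HiddenChargeMazurStaticKuboStubLasotaYorkeAux2

/-!
# `HiddenChargeMazur.StaticKubo`, line `birth`, stub `stub_lasotaYorke` — aux 3: the synchronous-coupling estimate

Helper file (`--supports stmt-AtomisticToContinuum-13510`, crux decl `HiddenChargeMazur.StaticKubo`,
skeleton `Cruxes/StaticKubo/Lines/birth.lean` rev 4, stub S5 `stub_lasotaYorke` of the lead).

For the pinned anharmonic chain at equal bath temperatures `T`, two starts `x, y` driven by the SAME Brownian
pair (`X = X_t^x(ω)`, `Y = X_t^y(ω)`):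

* `abs_forecast_sub_le_lintegral` — `|P_tφ(x) − P_tφ(y)| ≤ E|φ(X) − φ(Y)|` (as a lower integral);
* `coupling_pointwise` — the elementary pointwise inequality: if `‖X − Y‖ ≤ d`, `|φ| ≤ M·V` and
  `|φX − φY| ≤ K‖X−Y‖(W X + W Y)` on `‖X − Y‖ ≤ 1`, then `|φX − φY| ≤ d (K(WX + WY) + M(VX + VY))`
  (on `‖X−Y‖ > 1` the value bound is multiplied by `‖X − Y‖ ≤ d`);
* `measurable_flowRate` — the coupling rate `Λ(ω) = ∫₀¹ C₀(1 + √H(X_s^x) + √H(X_s^y)) ds` is measurable;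
* `lintegral_abs_sub_le_of_coupling` — **the integrated coupling estimate**: with `‖X−Y‖ ≤ ‖x−y‖e^{Λ}` and second
  moment bounds `E W(X)² ≤ B_x`, `E W(Y)² ≤ B_y`, `E V(X)² ≤ D_x`, `E V(Y)² ≤ D_y`,
  `E|φX − φY| ≤ ‖x−y‖ √G (K(√B_x + √B_y) + M(√D_x + √D_y))`, `G` the bound of `E e^{2Λ}` of aux 2.

References: folklore (coupling, Cauchy–Schwarz). Nothing here closes the item.
-/

noncomputable section

open MeasureTheory Filter Topology Set Metric
open scoped NNReal ENNReal
open Literature.MathematicalPhysics.KineticTheory.HeatConduction Literature.MathematicalPhysics.KineticTheory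
open Literature.Probability.Process OscillatorChain

namespace Summit.AtomisticToContinuum.FouriersLaw.Cruxes.StaticKubo.Birth.Stubs

variable {N : ℕ}

/-! ### The pointwise coupling inequality -/

/-- **The pointwise coupling inequality** (pure real bookkeeping). If `0 ≤ D ≤ d`, `|a| ≤ M vX`, `|b| ≤ M vY`
and `D ≤ 1 → |a − b| ≤ K D (wX + wY)` (all weights and constants nonnegative), then
`|a − b| ≤ d (K (wX + wY) + M (vX + vY))`. [folklore] -/
theorem coupling_pointwise :
    ∀ (a b wX wY vX vY D d K M : ℝ), 0 ≤ K → 0 ≤ M → 0 ≤ wX → 0 ≤ wY → 0 ≤ vX → 0 ≤ vY → 0 ≤ D → D ≤ d →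
      (D ≤ 1 → |a - b| ≤ K * D * (wX + wY)) → |a| ≤ M * vX → |b| ≤ M * vY →
      |a - b| ≤ d * (K * (wX + wY) + M * (vX + vY)) := by
  intro a b wX wY vX vY D d K M hK hM hwX hwY hvX hvY hD hDd hpair ha hb
  have hd : 0 ≤ d := hD.trans hDd
  rcases le_or_gt D 1 with h1 | h1
  · have h := hpair h1
    calc |a - b| ≤ K * D * (wX + wY) := h
      _ ≤ K * d * (wX + wY) := by gcongr
      _ ≤ d * (K * (wX + wY) + M * (vX + vY)) := by nlinarith [mul_nonneg hM (add_nonneg hvX hvY)]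
  · have h2 : |a - b| ≤ M * (vX + vY) := by
      calc |a - b| ≤ |a| + |b| := abs_sub _ _
        _ ≤ M * vX + M * vY := add_le_add ha hb
        _ = M * (vX + vY) := by ring
    have h3 : M * (vX + vY) ≤ d * (M * (vX + vY)) := by
      have h0 : 0 ≤ M * (vX + vY) := mul_nonneg hM (add_nonneg hvX hvY)
      nlinarith
    calc |a - b| ≤ d * (M * (vX + vY)) := h2.trans h3
      _ ≤ d * (K * (wX + wY) + M * (vX + vY)) := by nlinarith [mul_nonneg hK (add_nonneg hwX hwY)]

section Flow

variable {ω₂ lam β γ : ℝ} (hω : 0 < ω₂) (hl : 0 ≤ lam) (hβ : 0 ≤ β) (hγ : 0 ≤ γ) (hN : 0 < N)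
  {T : ℝ} (hT : 0 < T)
include hω hl hβ hγ hN hT

-- the flow is a limit of Picard iterations: never let the unifier unfold it (heartbeats)
attribute [local irreducible] OscillatorChain.chainFlow

/-- **Forecast differences are controlled by the coupling**: for `φ` continuous with `|φ| ≤ M e^{ϑH}`,
`0 < ϑ < 1/T`, `|P_tφ(x) − P_tφ(y)| ≤ E|φ(X_t^x) − φ(X_t^y)|`. [folklore] -/
theorem abs_forecast_sub_le_lintegral {φ : PhaseSpace N → ℝ} (hφ : Continuous φ) {M ϑ : ℝ} (hϑ : 0 < ϑ)
    (hϑT : ϑ < 1 / T) (hb : ∀ z, |φ z| ≤ M * Real.exp (ϑ * (pinnedChain ω₂ lam β γ).hamiltonian N z))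
    (t : ℝ≥0) (x y : PhaseSpace N) :
    |(∫ z, φ z ∂((pinnedChain ω₂ lam β γ).transitionKernel N T T t x)) -
        ∫ z, φ z ∂((pinnedChain ω₂ lam β γ).transitionKernel N T T t y)| ≤
      (∫⁻ ω, ENNReal.ofReal |φ ((pinnedChain ω₂ lam β γ).solMap N T T t x (pairPath ω)) -
        φ ((pinnedChain ω₂ lam β γ).solMap N T T t y (pairPath ω))| ∂wienerPair).toReal := by
  set P := pinnedChain ω₂ lam β γ with hP
  have hx := pinnedChain_integral_transitionKernel hω hl hβ hγ N T T t x (g := φ) hφ.aestronglyMeasurable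
  have hy := pinnedChain_integral_transitionKernel hω hl hβ hγ N T T t y (g := φ) hφ.aestronglyMeasurable
  rw [hx, hy, ← integral_sub (integrable_comp_solMap_of_abs_le hω hl hβ hγ hN hT hφ hϑ hϑT hb t x)
    (integrable_comp_solMap_of_abs_le hω hl hβ hγ hN hT hφ hϑ hϑT hb t y)]
  have h := norm_integral_le_lintegral_norm (μ := wienerPair)
    (fun ω => φ (P.solMap N T T t x (pairPath ω)) - φ (P.solMap N T T t y (pairPath ω)))
  simpa only [Real.norm_eq_abs] using h

omit hN hT in
/-- The coupling rate `Λ(ω) = ∫₀¹ C₀(1 + √H(X_s^x ω) + √H(X_s^y ω)) ds` is measurable. [folklore] -/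
theorem measurable_flowRate (C₀ : ℝ) (x y : PhaseSpace N) :
    Measurable fun ω : WienerPair => ∫ s in (0 : ℝ)..1, C₀ * (1 +
      Real.sqrt ((pinnedChain ω₂ lam β γ).hamiltonian N ((pinnedChain ω₂ lam β γ).solMap N T T s x (pairPath ω))) +
      Real.sqrt ((pinnedChain ω₂ lam β γ).hamiltonian N ((pinnedChain ω₂ lam β γ).solMap N T T s y (pairPath ω)))) := by
  set P := pinnedChain ω₂ lam β γ with hP
  have hHm : Measurable (P.hamiltonian N) := (pinnedChain_continuous_hamiltonian ω₂ lam β γ N).measurable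
  have hux : Measurable fun q : WienerPair × ℝ => P.solMap N T T q.2 x (pairPath q.1) :=
    (pinnedChain_measurable_uncurry_solMap hω hl hβ hγ N T T).comp
      (measurable_snd.prodMk ((measurable_const (a := x)).prodMk (measurable_pairPath.comp measurable_fst)))
  have huy : Measurable fun q : WienerPair × ℝ => P.solMap N T T q.2 y (pairPath q.1) :=
    (pinnedChain_measurable_uncurry_solMap hω hl hβ hγ N T T).comp
      (measurable_snd.prodMk ((measurable_const (a := y)).prodMk (measurable_pairPath.comp measurable_fst)))
  have hfm : Measurable (Function.uncurry fun (ω : WienerPair) (s : ℝ) => C₀ * (1 +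
      Real.sqrt (P.hamiltonian N (P.solMap N T T s x (pairPath ω))) +
      Real.sqrt (P.hamiltonian N (P.solMap N T T s y (pairPath ω))))) :=
    (((hHm.comp hux).sqrt.const_add 1).add (hHm.comp huy).sqrt).const_mul _
  have h : Measurable fun ω : WienerPair => ∫ s in Ioc (0 : ℝ) 1, C₀ * (1 +
      Real.sqrt (P.hamiltonian N (P.solMap N T T s x (pairPath ω))) +
      Real.sqrt (P.hamiltonian N (P.solMap N T T s y (pairPath ω)))) :=
    (hfm.stronglyMeasurable.integral_prod_right' (ν := (volume : Measure ℝ).restrict (Ioc (0 : ℝ) 1))).measurable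
  have heq : (fun ω : WienerPair => ∫ s in (0 : ℝ)..1, C₀ * (1 +
      Real.sqrt (P.hamiltonian N (P.solMap N T T s x (pairPath ω))) +
      Real.sqrt (P.hamiltonian N (P.solMap N T T s y (pairPath ω))))) = fun ω : WienerPair => ∫ s in Ioc (0 : ℝ) 1, C₀ * (1 +
      Real.sqrt (P.hamiltonian N (P.solMap N T T s x (pairPath ω))) +
      Real.sqrt (P.hamiltonian N (P.solMap N T T s y (pairPath ω)))) := by
    funext ω
    rw [intervalIntegral.integral_of_le zero_le_one]
  rw [heq]
  exact h

/-- **The integrated coupling estimate.** Let `X = X_t^x`, `Y = X_t^y` (same noise), `W = e^{θ₁H}`, `V = e^{ϑH}`,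
and suppose `‖X − Y‖ ≤ ‖x − y‖ e^{Λ}` pathwise with the rate `Λ` of `measurable_flowRate` (`C₀ ≥ 0`). If `φ` is
continuous with `|φ| ≤ M V` and `|φX' − φY'| ≤ K‖X'−Y'‖(WX' + WY')` for `‖X'−Y'‖ ≤ 1`, and the second
moments satisfy `E W(X)² ≤ B_x`, `E W(Y)² ≤ B_y`, `E V(X)² ≤ D_x`, `E V(Y)² ≤ D_y`, then
`E|φX − φY| ≤ ‖x−y‖ √G (K(√B_x + √B_y) + M(√D_x + √D_y))` with
`G = exp(2C₀ + (8C₀²T + γ) + (4C₀²T + 1/(4T))(√Hx + √Hy))` (aux 2). [folklore] -/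
theorem lintegral_abs_sub_le_of_coupling {C₀ : ℝ} (hC : 0 ≤ C₀) (t : ℝ≥0) (x y : PhaseSpace N)
    (hD : ∀ ω : WienerPair, ‖(pinnedChain ω₂ lam β γ).solMap N T T t x (pairPath ω) -
        (pinnedChain ω₂ lam β γ).solMap N T T t y (pairPath ω)‖ ≤
      ‖x - y‖ * Real.exp (∫ s in (0 : ℝ)..1, C₀ * (1 +
        Real.sqrt ((pinnedChain ω₂ lam β γ).hamiltonian N ((pinnedChain ω₂ lam β γ).solMap N T T s x (pairPath ω))) +
        Real.sqrt ((pinnedChain ω₂ lam β γ).hamiltonian N ((pinnedChain ω₂ lam β γ).solMap N T T s y (pairPath ω))))))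
    {φ : PhaseSpace N → ℝ} {Mφ Kφ ϑ θ₁ : ℝ} (hM : 0 ≤ Mφ) (hK : 0 ≤ Kφ)
    (hval : ∀ z, |φ z| ≤ Mφ * Real.exp (ϑ * (pinnedChain ω₂ lam β γ).hamiltonian N z))
    (hpair : ∀ z z', ‖z - z'‖ ≤ 1 → |φ z - φ z'| ≤ Kφ * ‖z - z'‖ *
      (Real.exp (θ₁ * (pinnedChain ω₂ lam β γ).hamiltonian N z) + Real.exp (θ₁ * (pinnedChain ω₂ lam β γ).hamiltonian N z')))
    {Bx By Dx Dy : ℝ} (hBx0 : 0 ≤ Bx) (hBy0 : 0 ≤ By) (hDx0 : 0 ≤ Dx) (hDy0 : 0 ≤ Dy)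
    (hBx : ∫⁻ ω, ENNReal.ofReal (Real.exp (2 * θ₁ * (pinnedChain ω₂ lam β γ).hamiltonian N
        ((pinnedChain ω₂ lam β γ).solMap N T T t x (pairPath ω)))) ∂wienerPair ≤ ENNReal.ofReal Bx)
    (hBy : ∫⁻ ω, ENNReal.ofReal (Real.exp (2 * θ₁ * (pinnedChain ω₂ lam β γ).hamiltonian N
        ((pinnedChain ω₂ lam β γ).solMap N T T t y (pairPath ω)))) ∂wienerPair ≤ ENNReal.ofReal By)
    (hDx : ∫⁻ ω, ENNReal.ofReal (Real.exp (2 * ϑ * (pinnedChain ω₂ lam β γ).hamiltonian N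
        ((pinnedChain ω₂ lam β γ).solMap N T T t x (pairPath ω)))) ∂wienerPair ≤ ENNReal.ofReal Dx)
    (hDy : ∫⁻ ω, ENNReal.ofReal (Real.exp (2 * ϑ * (pinnedChain ω₂ lam β γ).hamiltonian N
        ((pinnedChain ω₂ lam β γ).solMap N T T t y (pairPath ω)))) ∂wienerPair ≤ ENNReal.ofReal Dy) :
    ∫⁻ ω, ENNReal.ofReal |φ ((pinnedChain ω₂ lam β γ).solMap N T T t x (pairPath ω)) -
        φ ((pinnedChain ω₂ lam β γ).solMap N T T t y (pairPath ω))| ∂wienerPair ≤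
      ENNReal.ofReal (‖x - y‖ * (Real.sqrt (Real.exp (2 * C₀ + (8 * C₀ ^ 2 * T + γ) +
        (4 * C₀ ^ 2 * T + 1 / (4 * T)) * (Real.sqrt ((pinnedChain ω₂ lam β γ).hamiltonian N x) +
          Real.sqrt ((pinnedChain ω₂ lam β γ).hamiltonian N y)))) *
        (Kφ * (Real.sqrt Bx + Real.sqrt By) + Mφ * (Real.sqrt Dx + Real.sqrt Dy)))) := by
  set P := pinnedChain ω₂ lam β γ with hP
  set H := P.hamiltonian N with hH
  have hHm : Measurable H := (pinnedChain_continuous_hamiltonian ω₂ lam β γ N).measurable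
  set X : WienerPair → PhaseSpace N := fun ω => P.solMap N T T t x (pairPath ω) with hX
  set Y : WienerPair → PhaseSpace N := fun ω => P.solMap N T T t y (pairPath ω) with hY
  have hXm : Measurable X := pinnedChain_measurable_solMap_pairPath_right hω hl hβ hγ N T T t x
  have hYm : Measurable Y := pinnedChain_measurable_solMap_pairPath_right hω hl hβ hγ N T T t y
  set Λ : WienerPair → ℝ := fun ω => ∫ s in (0 : ℝ)..1, C₀ * (1 + Real.sqrt (H (P.solMap N T T s x (pairPath ω))) +
    Real.sqrt (H (P.solMap N T T s y (pairPath ω)))) with hΛ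
  have hΛm : Measurable Λ := measurable_flowRate hω hl hβ hγ C₀ x y
  set E : WienerPair → ℝ := fun ω => Real.exp (Λ ω) with hE
  have hEm : Measurable E := Real.measurable_exp.comp hΛm
  set G : ℝ := Real.exp (2 * C₀ + (8 * C₀ ^ 2 * T + γ) + (4 * C₀ ^ 2 * T + 1 / (4 * T)) *
    (Real.sqrt (H x) + Real.sqrt (H y))) with hG
  -- the second moment of `E = e^Λ`
  have hE2 : ∫⁻ ω, ENNReal.ofReal (E ω ^ 2) ∂wienerPair ≤ ENNReal.ofReal G := by
    have h := lintegral_exp_mul_flowRate_le hω hl hβ hγ hN hT hC (p := 2) two_pos x y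
    have h2 : ∀ ω, E ω ^ 2 = Real.exp (2 * Λ ω) := fun ω => by
      rw [hE, ← Real.exp_nat_mul]; push_cast; ring_nf
    simp_rw [h2]
    refine h.trans (le_of_eq ?_)
    rw [hG]; congr 2; ring
  -- weights
  set W : PhaseSpace N → ℝ := fun z => Real.exp (θ₁ * H z) with hW
  set V : PhaseSpace N → ℝ := fun z => Real.exp (ϑ * H z) with hV
  have hWm : Measurable W := Real.measurable_exp.comp (hHm.const_mul _)
  have hVm : Measurable V := Real.measurable_exp.comp (hHm.const_mul _)
  have hsq : ∀ (c : ℝ) (z : PhaseSpace N), Real.exp (c * H z) ^ 2 = Real.exp (2 * c * H z) := fun c z => by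
    rw [← Real.exp_nat_mul]; push_cast; ring_nf
  -- pointwise inequality
  have hpt : ∀ ω, ENNReal.ofReal |φ (X ω) - φ (Y ω)| ≤
      ENNReal.ofReal ‖x - y‖ * (ENNReal.ofReal Kφ * (ENNReal.ofReal (E ω * W (X ω)) + ENNReal.ofReal (E ω * W (Y ω))) +
        ENNReal.ofReal Mφ * (ENNReal.ofReal (E ω * V (X ω)) + ENNReal.ofReal (E ω * V (Y ω)))) := by
    intro ω
    have hE0 : 0 ≤ E ω := (Real.exp_pos _).le
    have h := coupling_pointwise (φ (X ω)) (φ (Y ω)) (W (X ω)) (W (Y ω)) (V (X ω)) (V (Y ω)) ‖X ω - Y ω‖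
      (‖x - y‖ * E ω) Kφ Mφ hK hM (Real.exp_pos _).le (Real.exp_pos _).le (Real.exp_pos _).le (Real.exp_pos _).le
      (norm_nonneg _) (hD ω) (fun h1 => hpair (X ω) (Y ω) h1) (hval (X ω)) (hval (Y ω))
    refine (ENNReal.ofReal_le_ofReal h).trans (le_of_eq ?_)
    have hWX : 0 ≤ W (X ω) := (Real.exp_pos _).le
    have hWY : 0 ≤ W (Y ω) := (Real.exp_pos _).le
    have hVX : 0 ≤ V (X ω) := (Real.exp_pos _).le
    have hVY : 0 ≤ V (Y ω) := (Real.exp_pos _).le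
    rw [← ENNReal.ofReal_add (mul_nonneg hE0 hWX) (mul_nonneg hE0 hWY),
      ← ENNReal.ofReal_add (mul_nonneg hE0 hVX) (mul_nonneg hE0 hVY), ← ENNReal.ofReal_mul hK, ← ENNReal.ofReal_mul hM,
      ← ENNReal.ofReal_add (mul_nonneg hK (add_nonneg (mul_nonneg hE0 hWX) (mul_nonneg hE0 hWY)))
        (mul_nonneg hM (add_nonneg (mul_nonneg hE0 hVX) (mul_nonneg hE0 hVY))), ← ENNReal.ofReal_mul (norm_nonneg _)]
    congr 1; ring
  refine (lintegral_mono hpt).trans ?_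
  -- linearity
  have hm1 : Measurable fun ω => ENNReal.ofReal (E ω * W (X ω)) := ENNReal.measurable_ofReal.comp (hEm.mul (hWm.comp hXm))
  have hm2 : Measurable fun ω => ENNReal.ofReal (E ω * W (Y ω)) := ENNReal.measurable_ofReal.comp (hEm.mul (hWm.comp hYm))
  have hm3 : Measurable fun ω => ENNReal.ofReal (E ω * V (X ω)) := ENNReal.measurable_ofReal.comp (hEm.mul (hVm.comp hXm))
  have hm4 : Measurable fun ω => ENNReal.ofReal (E ω * V (Y ω)) := ENNReal.measurable_ofReal.comp (hEm.mul (hVm.comp hYm))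
  have hmW : Measurable fun ω => ENNReal.ofReal (E ω * W (X ω)) + ENNReal.ofReal (E ω * W (Y ω)) := hm1.add hm2
  have hmV : Measurable fun ω => ENNReal.ofReal (E ω * V (X ω)) + ENNReal.ofReal (E ω * V (Y ω)) := hm3.add hm4
  have hmW' : Measurable fun ω => ENNReal.ofReal Kφ * (ENNReal.ofReal (E ω * W (X ω)) + ENNReal.ofReal (E ω * W (Y ω))) :=
    hmW.const_mul _
  have hmV' : Measurable fun ω => ENNReal.ofReal Mφ * (ENNReal.ofReal (E ω * V (X ω)) + ENNReal.ofReal (E ω * V (Y ω))) :=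
    hmV.const_mul _
  have hmAll : Measurable fun ω => ENNReal.ofReal Kφ * (ENNReal.ofReal (E ω * W (X ω)) + ENNReal.ofReal (E ω * W (Y ω))) +
      ENNReal.ofReal Mφ * (ENNReal.ofReal (E ω * V (X ω)) + ENNReal.ofReal (E ω * V (Y ω))) := hmW'.add hmV'
  rw [lintegral_const_mul _ hmAll, lintegral_add_left hmW', lintegral_const_mul _ hmW, lintegral_const_mul _ hmV,
    lintegral_add_left hm1, lintegral_add_left hm3]
  -- Cauchy–Schwarz for the four terms
  have hE0 : ∀ ω, 0 ≤ E ω := fun ω => (Real.exp_pos _).le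
  have hcs := fun (w : PhaseSpace N → ℝ) (hw : Measurable w) (hw0 : ∀ z, 0 ≤ w z) (Z : WienerPair → PhaseSpace N)
    (hZ : Measurable Z) (B : ℝ) (hB0 : 0 ≤ B) (hIB : ∫⁻ ω, ENNReal.ofReal (w (Z ω) ^ 2) ∂wienerPair ≤ ENNReal.ofReal B) =>
    lintegral_ofReal_mul_le wienerPair hEm (hw.comp hZ) hE0 (fun ω => hw0 (Z ω)) (Real.exp_pos _).le hB0 hE2 hIB
  have h1 : ∫⁻ ω, ENNReal.ofReal (E ω * W (X ω)) ∂wienerPair ≤ ENNReal.ofReal (Real.sqrt G * Real.sqrt Bx) :=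
    hcs W hWm (fun z => (Real.exp_pos _).le) X hXm Bx hBx0 (by simp_rw [hW, hsq]; exact hBx)
  have h2 : ∫⁻ ω, ENNReal.ofReal (E ω * W (Y ω)) ∂wienerPair ≤ ENNReal.ofReal (Real.sqrt G * Real.sqrt By) :=
    hcs W hWm (fun z => (Real.exp_pos _).le) Y hYm By hBy0 (by simp_rw [hW, hsq]; exact hBy)
  have h3 : ∫⁻ ω, ENNReal.ofReal (E ω * V (X ω)) ∂wienerPair ≤ ENNReal.ofReal (Real.sqrt G * Real.sqrt Dx) :=
    hcs V hVm (fun z => (Real.exp_pos _).le) X hXm Dx hDx0 (by simp_rw [hV, hsq]; exact hDx)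
  have h4 : ∫⁻ ω, ENNReal.ofReal (E ω * V (Y ω)) ∂wienerPair ≤ ENNReal.ofReal (Real.sqrt G * Real.sqrt Dy) :=
    hcs V hVm (fun z => (Real.exp_pos _).le) Y hYm Dy hDy0 (by simp_rw [hV, hsq]; exact hDy)
  calc ENNReal.ofReal ‖x - y‖ * (ENNReal.ofReal Kφ * ((∫⁻ ω, ENNReal.ofReal (E ω * W (X ω)) ∂wienerPair) +
        ∫⁻ ω, ENNReal.ofReal (E ω * W (Y ω)) ∂wienerPair) + ENNReal.ofReal Mφ *
        ((∫⁻ ω, ENNReal.ofReal (E ω * V (X ω)) ∂wienerPair) + ∫⁻ ω, ENNReal.ofReal (E ω * V (Y ω)) ∂wienerPair))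
      ≤ ENNReal.ofReal ‖x - y‖ * (ENNReal.ofReal Kφ * (ENNReal.ofReal (Real.sqrt G * Real.sqrt Bx) +
          ENNReal.ofReal (Real.sqrt G * Real.sqrt By)) + ENNReal.ofReal Mφ *
          (ENNReal.ofReal (Real.sqrt G * Real.sqrt Dx) + ENNReal.ofReal (Real.sqrt G * Real.sqrt Dy))) :=
        mul_le_mul_right (add_le_add (mul_le_mul_right (add_le_add h1 h2) _) (mul_le_mul_right (add_le_add h3 h4) _)) _
    _ = _ := by
        have hs : ∀ u v : ℝ, 0 ≤ Real.sqrt u * Real.sqrt v := fun u v =>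
          mul_nonneg (Real.sqrt_nonneg _) (Real.sqrt_nonneg _)
        rw [← ENNReal.ofReal_add (hs _ _) (hs _ _), ← ENNReal.ofReal_add (hs _ _) (hs _ _), ← ENNReal.ofReal_mul hK,
          ← ENNReal.ofReal_mul hM,
          ← ENNReal.ofReal_add (mul_nonneg hK (add_nonneg (hs _ _) (hs _ _))) (mul_nonneg hM (add_nonneg (hs _ _) (hs _ _))),
          ← ENNReal.ofReal_mul (norm_nonneg _)]
        congr 1; ring

end Flow

end Summit.AtomisticToContinuum.FouriersLaw.Cruxes.StaticKubo.Birth.Stubs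

end
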